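import Literature.NumberTheory.Transcendental.GaGmSubgroups
import Mathlib.LinearAlgebra.Dimension.OrzechProperty
import Mathlib.LinearAlgebra.Matrix.Rank
import Mathlib.RingTheory.AlgebraicIndependent.TranscendenceBasis
import Literature.RingTheory.KrullDimension.AffineDimension
import HarnessLib

/-!
# Dimension and degree of the connected subgroups `V × T_A` of `𝔾ₐ × 𝔾ₘⁿ`

Topic `Literature/NumberTheory/Transcendental`. For an irreducible closed subgroup
`H₀ ≤ ℂ × (ℂˣ)ⁿ`, identified with `𝓗 = GaGm.toConnAlgSubgroup H₀ _ = V × T_A`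
(`GaGmSubgroups.lean`), this file PROVES the two numerical facts used by the descent in
Philippon's zero estimate (`Philippon1986_GaGm_P1n`, clause (i)):

* `GaGm.dimG_eq_addDim_add_torusDim` : `dim H₀ = dim V + dim T_A`
  (`dim T_A = 𝓗.torusDim = n - rank A`);
* `GaGm.pow_le_mult` : `mult_{D₀,D₁}(H₀) ≥ D₀^{dim V} · D₁^{dim T_A}` for the bidegree-`(D₀, D₁)`
  multiplicity `GaGm.mult` of `GaGmBezout.lean`.

Ingredients (all proved here): lattice data for `A = charGroup H₀ ≤ ℤⁿ`
(`exists_latticeData`: a `ℚ`-basis `χ₁..χ_r` of `A ⊗ ℚ` inside `A`, unit vectors `e_j`,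
`j ∈ Jc`, `#Jc = n - r`, completing it to a basis, and the integer relations
`N e_k = ∑ mᵢ χᵢ + ∑ d_j e_j`); `dim {v ; ⟨χ, v⟩ = 0 ∀ χ ∈ A} = #Jc` (`finrank_tangentOf`, rank of
a matrix with independent rows); the upper bound `dim H₀ ≤ dim V + #Jc` by transcendence degree
(`dimG_le_addDim_add_card`: the `Y_k`, `k ∉ Jc`, are algebraic over `ℂ[X?, Y_j (j ∈ Jc)]`
modulo `𝔍(H₀)`; Mathlib `Algebra.IsAlgebraic.trdeg_le_cardinalMk` and
`Literature.RingTheory.KrullDimension.ringKrullDim_eq_trdeg`); the lower bound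
`H_{H₀}(t) ≥ (tD₀+1)^{dim V} (tD₁+1)^{#Jc}` (`pow_mul_pow_le_hilb`: box monomials supported on
`Jc` are independent modulo `𝔍(H₀)` by Artin's independence of characters); and the limit
`dim! · H(t)/t^{dim} → mult` (`GaGm.HasMult.tendsto`).

## References

* Yu. V. Nesterenko, P. Philippon (eds.), LNM 1752 (2001), Ch. 11 (D. Roy), §4; Ch. 5–7.
  [NesterenkoPhilippon2001]
* P. Philippon, Bull. Soc. Math. France 114 (1986), 355–383, Prop. 3.3, §4. [Philippon1986]
* A. Borel, *Linear Algebraic Groups*, GTM 126, §8.5 (characters of diagonalizable groups).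
-/

noncomputable section

open MvPolynomial Module
open scoped Pointwise

namespace Literature.NumberTheory.Transcendental

namespace GaGm

variable {n : ℕ}

/-! ### Lattice data of a subgroup `A ≤ ℤⁿ` -/

/-- Integer vectors as rational vectors. [folklore] -/
def castQ (χ : Fin n → ℤ) : Fin n → ℚ := fun j => (χ j : ℚ)

/-- Integer vectors as complex vectors. [folklore] -/
def castC (χ : Fin n → ℤ) : Fin n → ℂ := fun j => (χ j : ℂ)

/-- Rational vectors as complex vectors, a `ℚ`-linear map. [folklore] -/
def castQC : (Fin n → ℚ) →ₗ[ℚ] (Fin n → ℂ) where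
  toFun v := fun j => (v j : ℂ)
  map_add' v w := by funext j; simp
  map_smul' q v := by funext j; simp [Algebra.smul_def]

/-- Unfolding `castQC`. [folklore] -/
@[simp] theorem castQC_apply (v : Fin n → ℚ) (j : Fin n) : castQC v j = (v j : ℂ) := rfl

/-- `castQC ∘ castQ = castC`. [folklore] -/
theorem castQC_castQ (χ : Fin n → ℤ) : castQC (castQ χ) = castC χ := by
  funext j; simp [castQ, castC]

/-- `castQC` of a unit vector. [folklore] -/
theorem castQC_single (j : Fin n) : castQC (Pi.single j (1 : ℚ)) = Pi.single j (1 : ℂ) := by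
  funext i
  by_cases h : i = j
  · subst h; simp
  · simp [Pi.single_eq_of_ne h]

/-- `castQ` as an additive monoid homomorphism. [folklore] -/
def castQHom : (Fin n → ℤ) →+ (Fin n → ℚ) where
  toFun := castQ
  map_zero' := by funext j; simp [castQ]
  map_add' v w := by funext j; simp [castQ]

/-- Unfolding `castQHom`. [folklore] -/
theorem castQHom_apply (v : Fin n → ℤ) : castQHom v = castQ v := rfl

/-- `castQ` is `ℤ`-linear. [folklore] -/
theorem castQ_zsmul (z : ℤ) (v : Fin n → ℤ) : castQ (z • v) = (z : ℚ) • castQ v := by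
  funext j; simp [castQ]

/-- `castQ` of a unit vector. [folklore] -/
theorem castQ_single (k : Fin n) : castQ (Pi.single k (1 : ℤ)) = Pi.single k (1 : ℚ) := by
  funext i
  by_cases h : i = k
  · subst h; simp [castQ]
  · simp [castQ, Pi.single_eq_of_ne h]

/-- `castQ` is injective. [folklore] -/
theorem castQ_injective : Function.Injective (castQ (n := n)) := by
  intro v w h
  funext j
  have := congrFun h j
  simpa [castQ] using this

/-- **Lattice data.** For a subgroup `A ≤ ℤⁿ` there are `χ₁, …, χ_r ∈ A` and a set `Jc` of
`n - r` coordinates such that the `χᵢ` together with the unit vectors `e_j`, `j ∈ Jc`, are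
`ℂ`-linearly independent (hence a basis of `ℂⁿ`), and every element of `A` is a rational
combination of the `χᵢ`. (A `ℚ`-basis of `A ⊗ ℚ` inside `A`, extended by unit vectors.)
[folklore] -/
theorem exists_latticeData (A : AddSubgroup (Fin n → ℤ)) :
    ∃ (r : ℕ) (b : Fin r → (Fin n → ℤ)) (Jc : Finset (Fin n)),
      (∀ i, b i ∈ A) ∧ Jc.card + r = n ∧
      LinearIndependent ℂ (Sum.elim (fun i => castC (b i)) (fun j : ↥Jc => Pi.single (j : Fin n) (1 : ℂ))) ∧
      (∀ χ ∈ A, castQ χ ∈ Submodule.span ℚ (Set.range fun i => castQ (b i))) ∧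
      ∀ k : Fin n, ∃ (N : ℕ) (m : Fin r → ℤ) (d : ↥Jc → ℤ), 0 < N ∧
        (N : ℤ) • (Pi.single k (1 : ℤ) : Fin n → ℤ) = ∑ i, m i • b i + ∑ j, d j • Pi.single (j : Fin n) (1 : ℤ) := by
  classical
  -- a `ℚ`-basis of `span (castQ '' A)` inside `castQ '' A`
  obtain ⟨s, hsA, hspan, hli⟩ := exists_linearIndependent ℚ (castQ '' (A : Set (Fin n → ℤ)))
  have hliOn : LinearIndepOn ℚ id s := hli
  -- extend by unit vectors to a basis of `ℚⁿ`
  set E : Set (Fin n → ℚ) := Set.range fun j : Fin n => Pi.single j (1 : ℚ) with hE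
  set t : Set (Fin n → ℚ) := s ∪ E with ht
  set B : Set (Fin n → ℚ) := hliOn.extend (Set.subset_union_left : s ⊆ t) with hB
  have hBt : B ⊆ t := hliOn.extend_subset _
  have hsB : s ⊆ B := hliOn.subset_extend _
  have hBli : LinearIndepOn ℚ id B := hliOn.linearIndepOn_extend _
  have hBspan : Submodule.span ℚ B = ⊤ := by
    rw [hB, hliOn.span_extend_eq_span, eq_top_iff, ← (Pi.basisFun ℚ (Fin n)).span_eq]
    refine Submodule.span_mono ?_
    rintro _ ⟨j, rfl⟩
    exact Or.inr ⟨j, by simp [Pi.basisFun_apply]⟩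
  -- finiteness and cardinalities
  have hBfin : B.Finite := hBli.linearIndependent.setFinite
  have hsfin : s.Finite := hBfin.subset hsB
  haveI : Fintype ↥B := hBfin.fintype
  haveI : Fintype ↥s := hsfin.fintype
  have hcardB : Fintype.card ↥B = n := by
    have hb := Module.Basis.mk hBli.linearIndependent (by
      change ⊤ ≤ Submodule.span ℚ (Set.range fun x : ↥B => (x : Fin n → ℚ))
      rw [Subtype.range_coe_subtype, Set.setOf_mem_eq, hBspan])
    have := Module.finrank_eq_card_basis hb
    rw [Module.finrank_fin_fun] at this
    exact this.symm
  -- the new unit vectors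
  set Jc : Finset (Fin n) := Finset.univ.filter (fun j => Pi.single j (1 : ℚ) ∈ B ∧ Pi.single j (1 : ℚ) ∉ s)
    with hJc
  have hBeq : B = s ∪ (fun j : Fin n => Pi.single j (1 : ℚ)) '' ↑Jc := by
    apply Set.Subset.antisymm
    · intro x hx
      rcases hBt hx with hxs | ⟨j, rfl⟩
      · exact Or.inl hxs
      · by_cases hjs : Pi.single j (1 : ℚ) ∈ s
        · exact Or.inl hjs
        · refine Or.inr ⟨j, ?_, rfl⟩
          rw [Finset.mem_coe, hJc, Finset.mem_filter]
          exact ⟨Finset.mem_univ _, hx, hjs⟩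
    · rintro x (hxs | ⟨j, hj, rfl⟩)
      · exact hsB hxs
      · rw [Finset.mem_coe, hJc, Finset.mem_filter] at hj
        exact hj.2.1
  have hdisj : Disjoint s ((fun j : Fin n => Pi.single j (1 : ℚ)) '' ↑Jc) := by
    rw [Set.disjoint_left]
    rintro x hxs ⟨j, hj, rfl⟩
    rw [Finset.mem_coe, hJc, Finset.mem_filter] at hj
    exact hj.2.2 hxs
  have hsingle_inj : Function.Injective (fun j : Fin n => Pi.single j (1 : ℚ)) := by
    intro j j' h
    by_contra hne
    have := congrFun h j
    simp only [Pi.single_eq_same] at this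
    rw [Pi.single_eq_of_ne hne] at this
    exact one_ne_zero this
  -- enumerate `s` and choose preimages in `A`
  set r := Fintype.card ↥s with hr
  let es : Fin r ≃ ↥s := (Fintype.equivFin ↥s).symm
  have hpre : ∀ i : Fin r, ∃ χ ∈ A, castQ χ = (es i : Fin n → ℚ) := fun i => by
    obtain ⟨χ, hχ, e⟩ := hsA (es i).2
    exact ⟨χ, hχ, e⟩
  choose b hbA hb using hpre
  have hrange_b : Set.range (fun i => castQ (b i)) = s := by
    ext x
    constructor
    · rintro ⟨i, rfl⟩; change castQ (b i) ∈ s; rw [hb]; exact (es i).2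
    · intro hx; refine ⟨es.symm ⟨x, hx⟩, ?_⟩; change castQ (b _) = x; rw [hb]; simp
  -- cardinalities
  have hcard : Jc.card + r = n := by
    have h1 : Fintype.card ↥B = hBfin.toFinset.card := (hBfin.card_toFinset).symm
    have h2 : hBfin.toFinset = hsfin.toFinset ∪ Jc.image (fun j : Fin n => Pi.single j (1 : ℚ)) := by
      ext x
      rw [Set.Finite.mem_toFinset, Finset.mem_union, Set.Finite.mem_toFinset, Finset.mem_image, hBeq]
      simp only [Set.mem_union, Set.mem_image, Finset.mem_coe]
    have h3 : Disjoint hsfin.toFinset (Jc.image (fun j : Fin n => Pi.single j (1 : ℚ))) := by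
      rw [Finset.disjoint_left]
      intro x hx hx'
      rw [Set.Finite.mem_toFinset] at hx
      rw [Finset.mem_image] at hx'
      obtain ⟨j, hj, rfl⟩ := hx'
      exact Set.disjoint_left.mp hdisj hx ⟨j, hj, rfl⟩
    have h4 : hsfin.toFinset.card = r := by rw [hr]; exact hsfin.card_toFinset
    have h5 : Fintype.card ↥B = hsfin.toFinset.card + Jc.card := by
      rw [h1, h2, Finset.card_union_of_disjoint h3, Finset.card_image_of_injective _ hsingle_inj]
    omega
  refine ⟨r, b, Jc, hbA, hcard, ?_, ?_, ?_⟩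
  · -- `ℂ`-linear independence: `n` vectors spanning `ℂⁿ`
    apply linearIndependent_of_top_le_span_of_card_eq_finrank
    · -- the complex span contains the standard basis
      have hsub : castQC '' B ⊆ Set.range (Sum.elim (fun i => castC (b i)) (fun j : ↥Jc => Pi.single (j : Fin n) (1 : ℂ))) := by
        rintro _ ⟨x, hx, rfl⟩
        rw [hBeq] at hx
        rcases hx with hxs | ⟨j, hj, rfl⟩
        · refine ⟨Sum.inl (es.symm ⟨x, hxs⟩), ?_⟩
          simp only [Sum.elim_inl]
          rw [← castQC_castQ, hb]; simp
        · exact ⟨Sum.inr ⟨j, hj⟩, by simp [castQC_single]⟩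
      rw [← (Pi.basisFun ℂ (Fin n)).span_eq, Submodule.span_le]
      rintro _ ⟨j, rfl⟩
      rw [Pi.basisFun_apply]
      have hjQ : (Pi.single j (1 : ℚ) : Fin n → ℚ) ∈ Submodule.span ℚ B := by rw [hBspan]; trivial
      have h1 : castQC (Pi.single j (1 : ℚ)) ∈ Submodule.span ℚ (castQC '' B) := by
        rw [Submodule.span_image]; exact Submodule.mem_map_of_mem hjQ
      rw [castQC_single] at h1
      have h2 : Submodule.span ℚ (castQC '' B) ≤ (Submodule.span ℂ (castQC '' B)).restrictScalars ℚ :=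
        Submodule.span_le_restrictScalars ℚ ℂ _
      exact Submodule.span_mono hsub (h2 h1)
    · rw [Fintype.card_sum, Fintype.card_fin, Fintype.card_coe, Module.finrank_fin_fun]; omega
  · intro χ hχ
    rw [hrange_b, hspan]
    exact Submodule.subset_span ⟨χ, hχ, rfl⟩
  · -- integer relations for the unit vectors: clear denominators in `e_k ∈ span_ℚ B`
    intro k
    have hk : (Pi.single k (1 : ℚ) : Fin n → ℚ) ∈ Submodule.span ℚ B := by rw [hBspan]; trivial
    rw [hBeq, Submodule.span_union, Submodule.mem_sup] at hk
    obtain ⟨u, hu, w, hw, huw⟩ := hk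
    rw [← hrange_b, Submodule.mem_span_range_iff_exists_fun] at hu
    obtain ⟨q, rfl⟩ := hu
    rw [show ((fun j : Fin n => Pi.single j (1 : ℚ)) '' ↑Jc) = Set.range (fun j : ↥Jc => (Pi.single (j : Fin n) (1 : ℚ) : Fin n → ℚ)) by
      ext x; simp, Submodule.mem_span_range_iff_exists_fun] at hw
    obtain ⟨d, rfl⟩ := hw
    -- common denominator
    set N : ℕ := (∏ i, (q i).den) * ∏ j, (d j).den with hN
    have hNpos : 0 < N := by
      rw [hN]; exact Nat.mul_pos (Finset.prod_pos fun i _ => (q i).den_pos) (Finset.prod_pos fun j _ => (d j).den_pos)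
    have hdvd_q : ∀ i, (q i).den ∣ N := fun i =>
      (Finset.dvd_prod_of_mem (fun i => (q i).den) (Finset.mem_univ i)).mul_right _
    have hdvd_d : ∀ j, (d j).den ∣ N := fun j =>
      (Finset.dvd_prod_of_mem (fun j => (d j).den) (Finset.mem_univ j)).mul_left _
    -- `N x` is an integer when `den x ∣ N`
    have hint : ∀ x : ℚ, x.den ∣ N → (((N / x.den : ℕ) * x.num : ℤ) : ℚ) = (N : ℚ) * x := by
      intro x hx
      have h1 : ((N / x.den : ℕ) : ℚ) * (x.den : ℚ) = N := by
        rw [← Nat.cast_mul, Nat.div_mul_cancel hx]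
      rw [Int.cast_mul, Int.cast_natCast]
      calc ((N / x.den : ℕ) : ℚ) * (x.num : ℚ) = ((N / x.den : ℕ) : ℚ) * (x * x.den) := by rw [Rat.mul_den_eq_num]
        _ = (((N / x.den : ℕ) : ℚ) * x.den) * x := by ring
        _ = N * x := by rw [h1]
    refine ⟨N, fun i => (N / (q i).den : ℕ) * (q i).num, fun j => (N / (d j).den : ℕ) * (d j).num, hNpos, ?_⟩
    -- compare after casting to `ℚ`
    apply castQ_injective
    rw [castQ_zsmul, castQ_single, ← huw, ← castQHom_apply, map_add, map_sum, map_sum]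
    simp only [castQHom_apply, smul_add, Finset.smul_sum, smul_smul, Int.cast_natCast]
    congr 1
    · refine Finset.sum_congr rfl fun i _ => ?_
      funext j
      simp only [Pi.smul_apply, smul_eq_mul, castQ, Int.cast_mul, hint _ (hdvd_q i)]
    · refine Finset.sum_congr rfl fun i _ => ?_
      funext j
      simp only [Pi.smul_apply, smul_eq_mul, castQ, Int.cast_mul, hint _ (hdvd_d i)]
      by_cases h : j = (i : Fin n)
      · subst h; simp
      · simp [Pi.single_eq_of_ne h]

/-! ### The dimension of the torus tangent space `{v ; ⟨χ, v⟩ = 0 ∀ χ ∈ A}` -/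

/-- The annihilator of `A` in `ℂⁿ` under the standard pairing. [folklore] -/
def tangentOf (A : AddSubgroup (Fin n → ℤ)) : Submodule ℂ (Fin n → ℂ) where
  carrier := {v | ∀ χ ∈ A, ∑ j, (χ j : ℂ) * v j = 0}
  zero_mem' := by simp
  add_mem' := by
    intro v v' hv hv' χ hχ
    simp only [Pi.add_apply, mul_add, Finset.sum_add_distrib, hv χ hχ, hv' χ hχ, add_zero]
  smul_mem' := by
    intro c v hv χ hχ
    simp only [Pi.smul_apply, smul_eq_mul, mul_left_comm _ c, ← Finset.mul_sum, hv χ hχ, mul_zero]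

/-- `tangentOf` is literally `ConnAlgSubgroup.torusTangent`. [folklore] -/
theorem torusTangent_eq_tangentOf (𝓗 : ConnAlgSubgroup n) : 𝓗.torusTangent = tangentOf 𝓗.chars := rfl

/-- **`dim {v ; ⟨χ, v⟩ = 0 ∀ χ ∈ A} = n - rank A`**, in terms of lattice data. [folklore] -/
theorem finrank_tangentOf {A : AddSubgroup (Fin n → ℤ)} {r : ℕ} {b : Fin r → (Fin n → ℤ)}
    {Jc : Finset (Fin n)} (hbA : ∀ i, b i ∈ A) (hcard : Jc.card + r = n)
    (hli : LinearIndependent ℂ (Sum.elim (fun i => castC (b i)) (fun j : ↥Jc => Pi.single (j : Fin n) (1 : ℂ))))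
    (hspan : ∀ χ ∈ A, castQ χ ∈ Submodule.span ℚ (Set.range fun i => castQ (b i))) :
    finrank ℂ ↥(tangentOf A) = Jc.card := by
  classical
  -- the matrix of the `χᵢ`
  set M : Matrix (Fin r) (Fin n) ℂ := Matrix.of fun i j => (b i j : ℂ) with hM
  have hker : LinearMap.ker M.mulVecLin = tangentOf A := by
    ext v
    simp only [LinearMap.mem_ker, Matrix.mulVecLin_apply]
    constructor
    · intro hv χ hχ
      -- `χ` is a rational combination of the `b i`
      obtain ⟨q, hq⟩ := Submodule.mem_span_range_iff_exists_fun ℚ |>.mp (hspan χ hχ)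
      have hχj : ∀ j, (χ j : ℂ) = ∑ i, (q i : ℂ) * (b i j : ℂ) := by
        intro j
        have := congrFun hq j
        simp only [Finset.sum_apply, Pi.smul_apply, castQ, smul_eq_mul] at this
        have h2 := congrArg (fun x : ℚ => (x : ℂ)) this
        push_cast at h2
        exact h2.symm
      have hrow : ∀ i, ∑ j, (b i j : ℂ) * v j = 0 := fun i => by
        have := congrFun hv i
        simpa [Matrix.mulVec, dotProduct, hM] using this
      calc ∑ j, (χ j : ℂ) * v j = ∑ j, (∑ i, (q i : ℂ) * (b i j : ℂ)) * v j := by simp_rw [hχj]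
        _ = ∑ i, (q i : ℂ) * ∑ j, (b i j : ℂ) * v j := by
            simp_rw [Finset.sum_mul, Finset.mul_sum]
            rw [Finset.sum_comm]
            refine Finset.sum_congr rfl fun i _ => Finset.sum_congr rfl fun j _ => by ring
        _ = 0 := by simp [hrow]
    · intro hv
      funext i
      have := hv (b i) (hbA i)
      simpa [Matrix.mulVec, dotProduct, hM] using this
  -- rank of the matrix: the rows `b i` are independent
  have hrank : Matrix.rank M = r := by
    rw [Matrix.rank_eq_finrank_span_row]
    have hrows : LinearIndependent ℂ (fun i => M.row i) := by
      have h := hli.comp Sum.inl Sum.inl_injective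
      convert h using 1
      funext i
      ext j
      simp [Matrix.row, hM, castC]
    rw [finrank_span_eq_card hrows, Fintype.card_fin]
  have hrn := LinearMap.finrank_range_add_finrank_ker M.mulVecLin
  rw [hker, Module.finrank_fin_fun] at hrn
  change Matrix.rank M + finrank ℂ ↥(tangentOf A) = n at hrn
  omega

/-! ### Upper bound for the dimension of a connected subgroup (transcendence degree) -/

/-- Elements of an irreducible closed subgroup without additive part have trivial additive
coordinate. [folklore] -/
theorem fst_eq_one_of_not_addPart (H₀ : Subgroup (GaGm n)) (hirr : IsIrred (H₀ : Set (GaGm n)))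
    (hadd : (toConnAlgSubgroup H₀ hirr).addPart = false) {g : GaGm n} (hg : g ∈ H₀) : g.1 = 1 := by
  have h : g ∈ (toConnAlgSubgroup H₀ hirr).toSubgroup := by rw [toSubgroup_toConnAlgSubgroup]; exact hg
  exact h.1 hadd

/-- The coordinate `Y_j` is non-zero in `ℂ[X, Y] ⧸ 𝔍(H₀)`. [folklore] -/
theorem mk_X_succ_ne_zero (H₀ : Subgroup (GaGm n)) (j : Fin n) :
    Ideal.Quotient.mk (vanishing (H₀ : Set (GaGm n))) (X j.succ) ≠ 0 := by
  intro h
  rw [Ideal.Quotient.eq_zero_iff_mem] at h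
  have := h 1 H₀.one_mem
  simp [evalAt_eq_eval] at this

/-- The character `v ↦ y^v` of `ℤⁿ` attached to a torus point, as an additive homomorphism into
`Additive ℂˣ`. [folklore] -/
def cvHom (y : Fin n → ℂˣ) : (Fin n → ℤ) →+ Additive ℂˣ where
  toFun v := Additive.ofMul (∏ l, (y l) ^ (v l))
  map_zero' := by simp
  map_add' v w := by
    apply Additive.toMul.injective
    simp [zpow_add, Finset.prod_mul_distrib]

/-- Unfolding `cvHom`. [folklore] -/
theorem cvHom_apply (y : Fin n → ℂˣ) (v : Fin n → ℤ) : Additive.toMul (cvHom y v) = ∏ l, (y l) ^ (v l) := rfl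

/-- `y^{e_k} = y_k`. [folklore] -/
theorem cvHom_single (y : Fin n → ℂˣ) (k : Fin n) : Additive.toMul (cvHom y (Pi.single k (1 : ℤ))) = y k := by
  classical
  rw [cvHom_apply, Finset.prod_eq_single k (fun l _ hl => by rw [Pi.single_eq_of_ne hl, zpow_zero])
    (fun h => absurd (Finset.mem_univ k) h)]
  simp

/-- `y^{∑ cᵢ vᵢ} = ∏ (y^{vᵢ})^{cᵢ}`. [folklore] -/
theorem toMul_cvHom_sum_zsmul (y : Fin n → ℂˣ) {ι : Type*} (s : Finset ι) (c : ι → ℤ) (v : ι → (Fin n → ℤ)) :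
    Additive.toMul (cvHom y (∑ i ∈ s, c i • v i)) = ∏ i ∈ s, (Additive.toMul (cvHom y (v i))) ^ (c i) := by
  rw [map_sum, toMul_sum]
  refine Finset.prod_congr rfl fun i _ => ?_
  rw [map_zsmul, toMul_zsmul]

/-- From the integer relation `N e_k = ∑ mᵢ χᵢ + ∑ d_j e_j` with `χᵢ` trivial at `y`:
`y_k^N = ∏_j y_j^{d_j}`. [folklore] -/
theorem zpow_eq_prod_of_relation {y : Fin n → ℂˣ} {r : ℕ} {b : Fin r → (Fin n → ℤ)} {Jc : Finset (Fin n)}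
    (hb : ∀ i, ∏ l, (y l) ^ (b i l) = 1) {k : Fin n} {N : ℕ} {m : Fin r → ℤ} {d : ↥Jc → ℤ}
    (hrel : (N : ℤ) • (Pi.single k (1 : ℤ) : Fin n → ℤ) = ∑ i, m i • b i + ∑ j, d j • Pi.single (j : Fin n) (1 : ℤ)) :
    (y k) ^ (N : ℤ) = ∏ j : ↥Jc, (y j) ^ (d j) := by
  have h : Additive.toMul (cvHom y ((N : ℤ) • (Pi.single k (1 : ℤ) : Fin n → ℤ))) =
      Additive.toMul (cvHom y (∑ i, m i • b i + ∑ j, d j • Pi.single (j : Fin n) (1 : ℤ))) := by rw [hrel]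
  rw [map_zsmul, toMul_zsmul, cvHom_single, map_add, toMul_add, toMul_cvHom_sum_zsmul, toMul_cvHom_sum_zsmul] at h
  rw [h]
  have hb' : ∀ i, Additive.toMul (cvHom y (b i)) = 1 := fun i => by rw [cvHom_apply]; exact hb i
  simp only [hb', one_zpow, Finset.prod_const_one, one_mul, cvHom_single]

/-- **`dim H₀ ≤ dim V + #Jc`.** The coordinates `Y_k`, `k ∉ Jc`, of `ℂ[X, Y] ⧸ 𝔍(H₀)` are
algebraic over `ℂ[X (if V = 𝔾ₐ), Y_j (j ∈ Jc)]` thanks to the relations `N e_k = μ + ∑ d_j e_j`,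
`μ` trivial on `H₀`; so the transcendence degree, which is the Krull dimension
(`Literature.RingTheory.KrullDimension.ringKrullDim_eq_trdeg`), is at most `dim V + #Jc`
(`Algebra.IsAlgebraic.trdeg_le_cardinalMk`). [folklore] -/
theorem dimG_le_addDim_add_card (H₀ : Subgroup (GaGm n)) (hirr : IsIrred (H₀ : Set (GaGm n)))
    {r : ℕ} {b : Fin r → (Fin n → ℤ)} {Jc : Finset (Fin n)} (hbA : ∀ i, b i ∈ charGroup (H₀ : Set (GaGm n)))
    (hrel : ∀ k : Fin n, ∃ (N : ℕ) (m : Fin r → ℤ) (d : ↥Jc → ℤ), 0 < N ∧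
      (N : ℤ) • (Pi.single k (1 : ℤ) : Fin n → ℤ) = ∑ i, m i • b i + ∑ j, d j • Pi.single (j : Fin n) (1 : ℤ)) :
    dimG (H₀ : Set (GaGm n)) ≤ (toConnAlgSubgroup H₀ hirr).addDim + Jc.card := by
  classical
  haveI := hirr.isPrime
  set 𝔭 := vanishing (H₀ : Set (GaGm n)) with h𝔭
  haveI : IsDomain (MvPolynomial (Fin (n + 1)) ℂ ⧸ 𝔭) := Ideal.Quotient.isDomain _
  set mk : MvPolynomial (Fin (n + 1)) ℂ →ₐ[ℂ] MvPolynomial (Fin (n + 1)) ℂ ⧸ 𝔭 := Ideal.Quotient.mkₐ ℂ 𝔭 with hmk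
  have hmk' : ∀ Q, mk Q = Ideal.Quotient.mk 𝔭 Q := fun Q => rfl
  set 𝓗 := toConnAlgSubgroup H₀ hirr with h𝓗
  -- the small generating set
  set T : Finset (MvPolynomial (Fin (n + 1)) ℂ ⧸ 𝔭) :=
    (if 𝓗.addPart then {mk (X 0)} else ∅) ∪ Jc.image (fun j => mk (X j.succ)) with hT
  have hTcard : T.card ≤ 𝓗.addDim + Jc.card := by
    rw [hT]
    refine (Finset.card_union_le _ _).trans (Nat.add_le_add ?_ Finset.card_image_le)
    rw [ConnAlgSubgroup.addDim]
    split_ifs <;> simp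
  have hTmem : ∀ j ∈ Jc, mk (X j.succ) ∈ Algebra.adjoin ℂ (↑T : Set (MvPolynomial (Fin (n + 1)) ℂ ⧸ 𝔭)) := by
    intro j hj
    refine Algebra.subset_adjoin ?_
    rw [Finset.mem_coe, hT, Finset.mem_union]
    exact Or.inr (Finset.mem_image_of_mem _ hj)
  -- all the generators
  set S : Set (MvPolynomial (Fin (n + 1)) ℂ ⧸ 𝔭) := Set.range (mk ∘ X) with hS
  have hSgen : Algebra.adjoin ℂ S = ⊤ := by
    rw [hS, Set.range_comp, Algebra.adjoin_image, MvPolynomial.adjoin_range_X, Algebra.map_top,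
      AlgHom.range_eq_top]
    exact Ideal.Quotient.mkₐ_surjective ℂ _
  -- every generator outside `T` is algebraic over `ℂ[T]`
  have halgT : ∀ x ∈ S \ (↑T : Set (MvPolynomial (Fin (n + 1)) ℂ ⧸ 𝔭)),
      IsAlgebraic (Algebra.adjoin ℂ (↑T : Set (MvPolynomial (Fin (n + 1)) ℂ ⧸ 𝔭))) x := by
    rintro x ⟨⟨i, rfl⟩, hxT⟩
    revert hxT
    refine Fin.cases ?_ (fun k => ?_) i
    · -- `X 0`: either in `T` or zero
      intro hxT
      by_cases hadd : 𝓗.addPart = true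
      · exfalso; apply hxT
        rw [Finset.mem_coe, hT, Finset.mem_union]; left; rw [if_pos hadd]; exact Finset.mem_singleton_self _
      · have h0 : (mk ∘ X) 0 = 0 := by
          change mk (X 0) = 0
          rw [hmk', Ideal.Quotient.eq_zero_iff_mem]
          intro g hg
          rw [evalAt_eq_eval, MvPolynomial.eval_X, coord_zero,
            fst_eq_one_of_not_addPart H₀ hirr (Bool.eq_false_iff.mpr hadd) hg]
          rfl
        rw [h0]; exact isAlgebraic_zero
    · intro hxT
      by_cases hk : k ∈ Jc
      · exfalso; apply hxT
        rw [Finset.mem_coe, hT, Finset.mem_union]; right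
        exact Finset.mem_image_of_mem _ hk
      change IsAlgebraic _ (mk (X k.succ))
      -- the relation for `Y_k`
      obtain ⟨N, m, d, hN, hrelk⟩ := hrel k
      set u : MvPolynomial (Fin (n + 1)) ℂ ⧸ 𝔭 := ∏ j : ↥Jc, mk (X (j : Fin n).succ) ^ (-d j).toNat with hu
      set v : MvPolynomial (Fin (n + 1)) ℂ ⧸ 𝔭 := ∏ j : ↥Jc, mk (X (j : Fin n).succ) ^ (d j).toNat with hv
      have humem : u ∈ Algebra.adjoin ℂ (↑T : Set (MvPolynomial (Fin (n + 1)) ℂ ⧸ 𝔭)) :=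
        Subalgebra.prod_mem _ fun j _ => Subalgebra.pow_mem _ (hTmem j j.2) _
      have hvmem : v ∈ Algebra.adjoin ℂ (↑T : Set (MvPolynomial (Fin (n + 1)) ℂ ⧸ 𝔭)) :=
        Subalgebra.prod_mem _ fun j _ => Subalgebra.pow_mem _ (hTmem j j.2) _
      have hu0 : u ≠ 0 := Finset.prod_ne_zero_iff.mpr fun j _ => pow_ne_zero _ (mk_X_succ_ne_zero H₀ _)
      -- the relation in the quotient: `Y_k^N · u = v`
      have hrelR : mk (X k.succ) ^ N * u = v := by
        rw [hu, hv]
        simp only [hmk', ← map_pow, ← map_prod, ← map_mul]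
        rw [← sub_eq_zero, ← map_sub, Ideal.Quotient.eq_zero_iff_mem]
        intro g hg
        have hy : (g.2 k) ^ (N : ℤ) = ∏ j : ↥Jc, (g.2 j) ^ (d j) :=
          zpow_eq_prod_of_relation (fun i => hbA i g hg) hrelk
        -- in `ℂˣ`: `y_k^N ∏ y_j^{(-d)⁺} = ∏ y_j^{d⁺}`
        have hy' : (g.2 k) ^ N * ∏ j : ↥Jc, (g.2 j) ^ (-d j).toNat = ∏ j : ↥Jc, (g.2 j) ^ (d j).toNat := by
          rw [← zpow_natCast, hy, ← Finset.prod_mul_distrib]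
          refine Finset.prod_congr rfl fun j _ => ?_
          rw [← zpow_natCast, ← zpow_natCast, ← zpow_add]
          congr 1
          omega
        have hyC := congrArg (fun w : ℂˣ => (w : ℂ)) hy'
        rw [evalAt_eq_eval]
        simp only [map_sub, map_mul, map_pow, map_prod, MvPolynomial.eval_X, coord_succ, sub_eq_zero]
        push_cast at hyC
        exact hyC
      -- the polynomial `u Z^N - v`
      set K := Algebra.adjoin ℂ (↑T : Set (MvPolynomial (Fin (n + 1)) ℂ ⧸ 𝔭)) with hK
      set p : Polynomial ↥K := Polynomial.C (⟨u, humem⟩ : ↥K) * Polynomial.X ^ N - Polynomial.C ⟨v, hvmem⟩ with hp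
      refine ⟨p, ?_, ?_⟩
      · intro h0
        have h1 := congrArg (fun q : Polynomial ↥K => q.coeff N) h0
        simp only [hp] at h1
        rw [Polynomial.coeff_sub, Polynomial.coeff_C_mul_X_pow, if_pos rfl, Polynomial.coeff_C,
          if_neg (Nat.pos_iff_ne_zero.mp hN), sub_zero, Polynomial.coeff_zero] at h1
        exact hu0 (congrArg Subtype.val h1)
      · simp only [hp, map_sub, map_mul, Polynomial.aeval_C, Polynomial.aeval_X, map_pow, Subalgebra.algebraMap_def]
        change u * mk (X k.succ) ^ N - v = 0
        rw [mul_comm, hrelR, sub_self]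
  -- conclude with transcendence degree = dimension
  have halgS : ∀ a : MvPolynomial (Fin (n + 1)) ℂ ⧸ 𝔭, IsAlgebraic (Algebra.adjoin ℂ S) a := fun a => by
    have ha : a ∈ Algebra.adjoin ℂ S := by rw [hSgen]; exact Algebra.mem_top
    exact isAlgebraic_algebraMap (R := Algebra.adjoin ℂ S) (x := (⟨a, ha⟩ : Algebra.adjoin ℂ S))
  haveI : Algebra.IsAlgebraic (Algebra.adjoin ℂ (↑T : Set (MvPolynomial (Fin (n + 1)) ℂ ⧸ 𝔭)))
      (MvPolynomial (Fin (n + 1)) ℂ ⧸ 𝔭) :=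
    ⟨fun a => IsAlgebraic.adjoin_of_forall_isAlgebraic halgT (halgS a)⟩
  have htr : Algebra.trdeg ℂ (MvPolynomial (Fin (n + 1)) ℂ ⧸ 𝔭) ≤ T.card := by
    have h := Algebra.IsAlgebraic.trdeg_le_cardinalMk ℂ (A := MvPolynomial (Fin (n + 1)) ℂ ⧸ 𝔭)
      (↑T : Set (MvPolynomial (Fin (n + 1)) ℂ ⧸ 𝔭))
    rwa [Finset.coe_sort_coe, Cardinal.mk_coe_finset] at h
  have hdim := Literature.RingTheory.KrullDimension.ringKrullDim_eq_trdeg ℂ (MvPolynomial (Fin (n + 1)) ℂ ⧸ 𝔭)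
  rw [← dimG_eq hirr.nonempty] at hdim
  have hd : dimG (H₀ : Set (GaGm n)) = Cardinal.toNat (Algebra.trdeg ℂ (MvPolynomial (Fin (n + 1)) ℂ ⧸ 𝔭)) := by
    exact_mod_cast hdim
  rw [hd]
  refine le_trans ?_ hTcard
  have := Cardinal.toNat_le_toNat htr (Cardinal.natCast_lt_aleph0)
  rwa [Cardinal.toNat_natCast] at this

/-! ### Lower bound for the Hilbert function of a connected subgroup -/

/-- Evaluation of a monomial at a point of `G(ℂ)`. [folklore] -/
theorem evalAt_monomial (s : Fin (n + 1) →₀ ℕ) (c : ℂ) (g : GaGm n) :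
    evalAt (monomial s c) g = c * ((Multiplicative.toAdd g.1) ^ s 0 * charVal g.2 s) := by
  classical
  rw [evalAt_eq_eval, MvPolynomial.eval_monomial, Finsupp.prod_fintype _ _ (fun i => by simp), Fin.prod_univ_succ]
  simp [coord, charVal]

/-- With additive part, all of `ℂ × (torus points)` lies in the subgroup. [folklore] -/
theorem mem_of_addPart (H₀ : Subgroup (GaGm n)) (hirr : IsIrred (H₀ : Set (GaGm n)))
    (hadd : (toConnAlgSubgroup H₀ hirr).addPart = true) (x : ℂ) {y : Fin n → ℂˣ}
    (hy : ((1 : Multiplicative ℂ), y) ∈ H₀) : (Multiplicative.ofAdd x, y) ∈ H₀ := by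
  classical
  have h1 : (Multiplicative.ofAdd (1 : ℂ), (1 : Fin n → ℂˣ)) ∈ H₀ := by
    simpa [toConnAlgSubgroup] using hadd
  rcases addPart_dichotomy H₀ hirr.isClosedG with hall | hzero
  · have : (Multiplicative.ofAdd x, y) = (Multiplicative.ofAdd x, (1 : Fin n → ℂˣ)) * ((1 : Multiplicative ℂ), y) := by
      ext <;> simp
    rw [this]; exact H₀.mul_mem (hall x) hy
  · exact absurd (hzero 1 h1) one_ne_zero

/-- The exponents of the independent box monomials `X^i ∏_{j ∈ Jc} Y_j^{c_j}`. [folklore] -/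
def boxExp (Jc : Finset (Fin n)) {a : ℕ} {T : ℕ} (ic : Fin a × (↥Jc → Fin T)) : Fin (n + 1) →₀ ℕ :=
  Finsupp.equivFunOnFinite.symm (Fin.cons (ic.1 : ℕ) (fun l => if h : l ∈ Jc then ((ic.2 ⟨l, h⟩ : Fin T) : ℕ) else 0))

/-- The `X`-exponent of `boxExp`. [folklore] -/
theorem boxExp_zero (Jc : Finset (Fin n)) {a T : ℕ} (ic : Fin a × (↥Jc → Fin T)) : boxExp Jc ic 0 = ic.1 := by
  simp [boxExp]

/-- The `Y`-exponents of `boxExp`. [folklore] -/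
theorem boxExp_succ (Jc : Finset (Fin n)) {a T : ℕ} (ic : Fin a × (↥Jc → Fin T)) (l : Fin n) :
    boxExp Jc ic l.succ = if h : l ∈ Jc then ((ic.2 ⟨l, h⟩ : Fin T) : ℕ) else 0 := by
  simp [boxExp]

/-- `boxExp` is injective. [folklore] -/
theorem boxExp_injective (Jc : Finset (Fin n)) {a T : ℕ} : Function.Injective (boxExp (n := n) Jc (a := a) (T := T)) := by
  intro ic ic' h
  refine Prod.ext (Fin.ext ?_) (funext fun j => Fin.ext ?_)
  · have := congrArg (fun s => s 0) h; simpa [boxExp_zero] using this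
  · have := congrArg (fun s => s (j : Fin n).succ) h
    simpa [boxExp_succ, j.2] using this

/-- **Lower bound `H_{H₀}(t) ≥ (tD₀+1)^{dim V} (tD₁+1)^{#Jc}`**: the box monomials
`X^i ∏_{j ∈ Jc} Y_j^{c_j}` are linearly independent modulo `𝔍(H₀)` (polynomial identity in `X`,
then distinct characters of `H₀` — distinct because a difference supported on `Jc` and lying in
`charGroup H₀ ⊗ ℚ` vanishes — are independent by Artin). [folklore] -/
theorem pow_mul_pow_le_hilb (D₀ D₁ : ℕ) (H₀ : Subgroup (GaGm n)) (hirr : IsIrred (H₀ : Set (GaGm n)))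
    {r : ℕ} {b : Fin r → (Fin n → ℤ)} {Jc : Finset (Fin n)}
    (hli : LinearIndependent ℂ (Sum.elim (fun i => castC (b i)) (fun j : ↥Jc => Pi.single (j : Fin n) (1 : ℂ))))
    (hspan : ∀ χ ∈ charGroup (H₀ : Set (GaGm n)), castQ χ ∈ Submodule.span ℚ (Set.range fun i => castQ (b i)))
    (t : ℕ) :
    (t * D₀ + 1) ^ (toConnAlgSubgroup H₀ hirr).addDim * (t * D₁ + 1) ^ Jc.card ≤ hilb D₀ D₁ (H₀ : Set (GaGm n)) t := by
  classical
  haveI := hirr.isPrime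
  set 𝓗 := toConnAlgSubgroup H₀ hirr with h𝓗
  set 𝔭 := vanishing (H₀ : Set (GaGm n)) with h𝔭
  -- the index set and the monomials
  set a : ℕ := if 𝓗.addPart then t * D₀ + 1 else 1 with ha
  let I := Fin a × (↥Jc → Fin (t * D₁ + 1))
  set fam : I → MvPolynomial (Fin (n + 1)) ℂ := fun ic => monomial (boxExp Jc ic) 1 with hfam
  have hcardI : Fintype.card I = (t * D₀ + 1) ^ 𝓗.addDim * (t * D₁ + 1) ^ Jc.card := by
    simp only [I, Fintype.card_prod, Fintype.card_fin, Fintype.card_pi, Finset.prod_const, Finset.card_univ,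
      Fintype.card_coe, ha, ConnAlgSubgroup.addDim]
    split_ifs <;> simp
  -- they lie in the box
  have ha_le : a ≤ t * D₀ + 1 := by rw [ha]; split_ifs <;> omega
  have hfamBox : ∀ ic, fam ic ∈ Box (n := n) D₀ D₁ t := by
    intro ic
    rw [hfam]
    refine (monomial_mem_restrictSupport ℂ).mpr (Or.inl ⟨?_, fun l => ?_⟩)
    · rw [boxExp_zero]
      have h1 : (ic.1 : ℕ) < a := ic.1.2
      omega
    · rw [boxExp_succ]
      split_ifs with h
      · have := (ic.2 ⟨l, h⟩).2; omega
      · exact Nat.zero_le _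
  -- they are linearly independent
  have hfamli : LinearIndependent ℂ fam := by
    have h := (MvPolynomial.basisMonomials (Fin (n + 1)) ℂ).linearIndependent.comp (boxExp Jc)
      (boxExp_injective (n := n) Jc (a := a) (T := t * D₁ + 1))
    have he : (⇑(MvPolynomial.basisMonomials (Fin (n + 1)) ℂ) ∘ boxExp Jc) = fam := by
      funext ic
      simp [hfam, MvPolynomial.coe_basisMonomials]
    rw [he] at h
    exact h
  -- the torus points of `H₀`
  let Hs : Subgroup (GaGm n) :=
    { carrier := {h | h ∈ H₀ ∧ h.1 = 1}
      one_mem' := ⟨H₀.one_mem, rfl⟩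
      mul_mem' := fun {u v} hu hv => ⟨H₀.mul_mem hu.1 hv.1, by rw [Prod.fst_mul, hu.2, hv.2, one_mul]⟩
      inv_mem' := fun {u} hu => ⟨H₀.inv_mem hu.1, by rw [Prod.fst_inv, hu.2, inv_one]⟩ }
  have hHs_char : charGroup ((Hs : Subgroup (GaGm n)) : Set (GaGm n)) = charGroup (H₀ : Set (GaGm n)) := by
    ext χ
    simp only [mem_charGroup_iff]
    constructor
    · intro h k hk
      exact h ((1 : Multiplicative ℂ), k.2) ⟨torusPart_mem H₀ hirr.isClosedG hk, rfl⟩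
    · intro h k hk
      exact h k hk.1
  -- for fixed `i`, the characters `c ↦ y^{boxExp (i, c)}` of `Hs` are pairwise distinct
  have hinj : ∀ i : Fin a, Function.Injective (fun c : ↥Jc → Fin (t * D₁ + 1) => monChar Hs (boxExp Jc (i, c))) := by
    intro i c c' hcc
    have hv := sub_mem_charGroup_of_monChar_eq hcc
    rw [hHs_char] at hv
    set v : Fin n → ℤ := fun j => (boxExp Jc (i, c') j.succ : ℤ) - boxExp Jc (i, c) j.succ with hvdef
    -- `v` is supported on `Jc`
    have hv0 : ∀ l, l ∉ Jc → v l = 0 := fun l hl => by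
      simp [hvdef, boxExp_succ, hl]
    -- `castC v` is a rational combination of the `χᵢ`
    obtain ⟨q, hq⟩ := (Submodule.mem_span_range_iff_exists_fun ℚ).mp (hspan v hv)
    have hC : ∑ i, ((q i : ℂ) • castC (b i)) = castC v := by
      have := congrArg castQC hq
      rw [map_sum, castQC_castQ] at this
      rw [← this]
      refine Finset.sum_congr rfl fun i _ => ?_
      rw [map_smul, castQC_castQ, ← algebraMap_smul ℂ (q i) (castC (b i))]
      simp [eq_ratCast]
    -- and a combination of the unit vectors `e_j`, `j ∈ Jc`
    have hE : ∑ j : ↥Jc, ((v j : ℂ) • (Pi.single (j : Fin n) (1 : ℂ) : Fin n → ℂ)) = castC v := by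
      funext l
      simp only [Finset.sum_apply, Pi.smul_apply, smul_eq_mul, castC]
      by_cases hl : l ∈ Jc
      · rw [Finset.sum_eq_single (⟨l, hl⟩ : ↥Jc)]
        · simp
        · intro j _ hj
          have : (l : Fin n) ≠ j := fun h => hj (Subtype.ext h.symm)
          rw [Pi.single_eq_of_ne this, mul_zero]
        · intro h; exact absurd (Finset.mem_univ _) h
      · rw [hv0 l hl, Int.cast_zero]
        refine Finset.sum_eq_zero fun j _ => ?_
        have : (l : Fin n) ≠ j := fun h => hl (h ▸ j.2)
        rw [Pi.single_eq_of_ne this, mul_zero]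
    -- independence forces `v = 0` on `Jc`
    let g : Fin r ⊕ ↥Jc → ℂ := Sum.elim (fun i => (q i : ℂ)) (fun j => -(v j : ℂ))
    have hrel : ∑ x, g x • Sum.elim (fun i => castC (b i)) (fun j : ↥Jc => (Pi.single (j : Fin n) (1 : ℂ) : Fin n → ℂ)) x = 0 := by
      rw [Fintype.sum_sum_type]
      simp only [g, Sum.elim_inl, Sum.elim_inr, neg_smul, Finset.sum_neg_distrib]
      rw [hC, hE, add_neg_cancel]
    have hzero := Fintype.linearIndependent_iff.mp hli g hrel
    funext j
    apply Fin.ext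
    have hj : -(v j : ℂ) = 0 := hzero (Sum.inr j)
    rw [neg_eq_zero, Int.cast_eq_zero, hvdef] at hj
    have hj' : (boxExp Jc (i, c') (j : Fin n).succ : ℤ) = boxExp Jc (i, c) (j : Fin n).succ := by
      have := hj; simp only at this; linarith
    have hj'' : boxExp Jc (i, c') (j : Fin n).succ = boxExp Jc (i, c) (j : Fin n).succ := by exact_mod_cast hj'
    rw [boxExp_succ, boxExp_succ, dif_pos j.2, dif_pos j.2] at hj''
    exact hj''.symm
  -- their span meets `𝔭` trivially
  have hinf : Submodule.span ℂ (Set.range fam) ⊓ 𝔭.restrictScalars ℂ = ⊥ := by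
    rw [Submodule.eq_bot_iff]
    rintro Q ⟨hQ, hQ𝔭⟩
    rw [SetLike.mem_coe, Submodule.mem_span_range_iff_exists_fun] at hQ
    obtain ⟨cf, rfl⟩ := hQ
    -- the value at `(x, y)`
    have hval : ∀ (x : ℂ) (y : Fin n → ℂˣ),
        evalAt (∑ ic, cf ic • fam ic) (Multiplicative.ofAdd x, y) =
          ∑ i : Fin a, (∑ c : ↥Jc → Fin (t * D₁ + 1), cf (i, c) * charVal y (boxExp Jc (i, c))) * x ^ (i : ℕ) := by
      intro x y
      rw [evalAt_eq_eval, map_sum, Fintype.sum_prod_type]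
      refine Finset.sum_congr rfl fun i _ => ?_
      rw [Finset.sum_mul]
      refine Finset.sum_congr rfl fun c _ => ?_
      rw [hfam]
      dsimp only
      rw [MvPolynomial.smul_eval, ← evalAt_eq_eval, evalAt_monomial, boxExp_zero]
      simp only [toAdd_ofAdd, one_mul]
      ring
    -- Step 1: for every torus point `y` of `H₀` and every `i`, `∑_c cf(i,c) y^{c} = 0`
    have step1 : ∀ y : Fin n → ℂˣ, ((1 : Multiplicative ℂ), y) ∈ H₀ → ∀ i : Fin a,
        ∑ c : ↥Jc → Fin (t * D₁ + 1), cf (i, c) * charVal y (boxExp Jc (i, c)) = 0 := by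
      intro y hy
      set coef : Fin a → ℂ := fun i => ∑ c : ↥Jc → Fin (t * D₁ + 1), cf (i, c) * charVal y (boxExp Jc (i, c))
        with hcoef
      set Pol : Polynomial ℂ := ∑ i : Fin a, Polynomial.C (coef i) * Polynomial.X ^ (i : ℕ) with hPol
      have hPev : ∀ x, Pol.eval x = ∑ i : Fin a, coef i * x ^ (i : ℕ) := by
        intro x; simp [hPol, Polynomial.eval_finsetSum]
      have hPcoeff : ∀ i : Fin a, Pol.coeff i = coef i := by
        intro i
        rw [hPol, Polynomial.finsetSum_coeff]
        simp only [Polynomial.coeff_C_mul_X_pow]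
        rw [Finset.sum_eq_single i]
        · simp
        · intro i' _ hi'
          rw [if_neg]
          exact fun h => hi' (Fin.ext h.symm)
        · intro h; exact absurd (Finset.mem_univ _) h
      -- `Pol = 0`
      have hP0 : Pol = 0 := by
        by_cases hadd : 𝓗.addPart = true
        · apply Polynomial.funext
          intro x
          rw [hPev, Polynomial.eval_zero, ← hval x y]
          exact hQ𝔭 _ (mem_of_addPart H₀ hirr hadd x hy)
        · -- `a = 1`: the polynomial is the constant `F(0) = 0`
          have ha1 : a = 1 := by rw [ha, if_neg hadd]
          have hdeg : Pol.natDegree ≤ 0 := by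
            rw [hPol]
            refine Polynomial.natDegree_sum_le_of_forall_le _ _ fun i _ => ?_
            refine (Polynomial.natDegree_C_mul_X_pow_le _ _).trans ?_
            have := i.2; omega
          have h0 : Pol.eval 0 = 0 := by
            rw [hPev, ← hval 0 y]
            exact hQ𝔭 _ (by simpa using hy)
          rw [Polynomial.eq_C_of_natDegree_le_zero hdeg, Polynomial.eval_C] at h0
          rw [Polynomial.eq_C_of_natDegree_le_zero hdeg, h0, map_zero]
      intro i
      change coef i = 0
      rw [← hPcoeff i, hP0, Polynomial.coeff_zero]
    -- Step 2: Artin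
    have hcf : ∀ ic, cf ic = 0 := by
      rintro ⟨i, c⟩
      have hliφ := (linearIndependent_monoidHom (↥Hs) ℂ).comp _ (hinj i)
      have h0 := Fintype.linearIndependent_iff.mp hliφ (fun c => cf (i, c)) (by
        funext k
        simp only [Function.comp_apply, Finset.sum_apply, Pi.smul_apply, smul_eq_mul, Pi.zero_apply,
          monChar_apply]
        have hk : ((1 : Multiplicative ℂ), (k : GaGm n).2) ∈ H₀ := by
          have : ((1 : Multiplicative ℂ), (k : GaGm n).2) = (k : GaGm n) := by ext <;> simp [k.2.2]
          rw [this]; exact k.2.1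
        exact step1 _ hk i)
      exact h0 c
    simp [hcf]
  -- conclusion: `span fam ⊕ (Box ⊓ 𝔭) ≤ Box`
  set W := Submodule.span ℂ (Set.range fam) with hW
  have hWle : W ≤ Box (n := n) D₀ D₁ t := Submodule.span_le.mpr (by rintro _ ⟨ic, rfl⟩; exact hfamBox ic)
  have hWfin : finrank ℂ ↥W = Fintype.card I := finrank_span_eq_card hfamli
  haveI : FiniteDimensional ℂ ↥W := FiniteDimensional.span_of_finite ℂ (Set.finite_range fam)
  haveI : FiniteDimensional ℂ ↥(Box (n := n) D₀ D₁ t ⊓ 𝔭.restrictScalars ℂ) :=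
    Submodule.finiteDimensional_inf_left _ _
  have h1 := Submodule.finrank_sup_add_finrank_inf_eq W (Box (n := n) D₀ D₁ t ⊓ 𝔭.restrictScalars ℂ)
  have h2 : W ⊓ (Box (n := n) D₀ D₁ t ⊓ 𝔭.restrictScalars ℂ) = ⊥ := by
    rw [eq_bot_iff, ← hinf]
    exact le_inf inf_le_left (inf_le_right.trans inf_le_right)
  rw [h2, finrank_bot, add_zero] at h1
  have h3 : finrank ℂ ↥(W ⊔ (Box (n := n) D₀ D₁ t ⊓ 𝔭.restrictScalars ℂ)) ≤ finrank ℂ ↥(Box (n := n) D₀ D₁ t) :=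
    Submodule.finrank_mono (sup_le hWle inf_le_left)
  have h4 := hilbI_add_finrank_inf (n := n) (D₀ := D₀) (D₁ := D₁) (𝔭.restrictScalars ℂ) t
  rw [← hcardI, ← hWfin]
  change _ ≤ hilbI D₀ D₁ (𝔭.restrictScalars ℂ) t
  omega

/-! ### Dimension and multiplicity of a connected subgroup -/

open Filter Topology in
/-- A sequence of naturals tending to a (real) limit and bounded below by `c * t` for `t ≥ 1`
forces `c = 0`. [folklore] -/
theorem eq_zero_of_tendsto_of_mul_le {f : ℕ → ℝ} {ρ : ℝ} (hf : Tendsto f atTop (𝓝 ρ)) {c : ℕ}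
    (h : ∀ t : ℕ, 1 ≤ t → (c : ℝ) * t ≤ f t) : c = 0 := by
  by_contra hc
  have hc1 : (1 : ℝ) ≤ c := by exact_mod_cast Nat.pos_of_ne_zero hc
  have hev : ∀ᶠ t : ℕ in atTop, f t < ρ + 1 := hf.eventually (gt_mem_nhds (lt_add_one ρ))
  rw [Filter.eventually_atTop] at hev
  obtain ⟨N, hN⟩ := hev
  obtain ⟨t, ht⟩ := exists_nat_gt (max (ρ + 1) (N + 1 : ℝ))
  have htN : N ≤ t := by
    have : (N : ℝ) + 1 ≤ max (ρ + 1) (N + 1 : ℝ) := le_max_right _ _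
    exact_mod_cast (by linarith : (N : ℝ) ≤ t)
  have ht1 : 1 ≤ t := by
    have : (N : ℝ) + 1 ≤ max (ρ + 1) (N + 1 : ℝ) := le_max_right _ _
    exact_mod_cast (by linarith : (1 : ℝ) ≤ t)
  have h1 := hN t htN
  have h2 := h t ht1
  have h3 : ρ + 1 < t := lt_of_le_of_lt (le_max_left _ _) ht
  have h4 : (t : ℝ) ≤ (c : ℝ) * t := by nlinarith
  linarith

open Filter Topology in
/-- **Dimension and degree of a connected subgroup.** For an irreducible closed subgroup
`H₀ = V × T_A`: `dim H₀ = dim V + dim T_A` and `mult_{D₀,D₁}(H₀) ≥ D₀^{dim V} D₁^{dim T_A}`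
(LNM 1752, Ch. 11, the computation behind Thm 4.1's `ℋ`; Philippon 1986, Prop. 3.3 & §4).
[folklore] -/
theorem dimG_eq_and_pow_le_mult {D₀ D₁ : ℕ} (hD₀ : 1 ≤ D₀) (hD₁ : 1 ≤ D₁) (H₀ : Subgroup (GaGm n))
    (hirr : IsIrred (H₀ : Set (GaGm n))) :
    dimG (H₀ : Set (GaGm n)) = (toConnAlgSubgroup H₀ hirr).addDim + (toConnAlgSubgroup H₀ hirr).torusDim ∧
      D₀ ^ (toConnAlgSubgroup H₀ hirr).addDim * D₁ ^ (toConnAlgSubgroup H₀ hirr).torusDim ≤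
        mult D₀ D₁ (H₀ : Set (GaGm n)) := by
  classical
  set 𝓗 := toConnAlgSubgroup H₀ hirr with h𝓗
  obtain ⟨r, b, Jc, hbA, hcard, hli, hspan, hrel⟩ := exists_latticeData (charGroup (H₀ : Set (GaGm n)))
  -- torus dimension
  have htor : 𝓗.torusDim = Jc.card := by
    rw [ConnAlgSubgroup.torusDim, torusTangent_eq_tangentOf, h𝓗, toConnAlgSubgroup_chars]
    exact finrank_tangentOf hbA hcard hli hspan
  rw [htor]
  set δ₀ := 𝓗.addDim with hδ₀
  set m := dimG (H₀ : Set (GaGm n)) with hm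
  -- upper bound
  have hup : m ≤ δ₀ + Jc.card := dimG_le_addDim_add_card H₀ hirr hbA hrel
  -- lower bound for the Hilbert function
  have hlow : ∀ t, D₀ ^ δ₀ * D₁ ^ Jc.card * t ^ (δ₀ + Jc.card) ≤ hilb D₀ D₁ (H₀ : Set (GaGm n)) t := by
    intro t
    refine le_trans ?_ (pow_mul_pow_le_hilb D₀ D₁ H₀ hirr hli hspan t)
    calc D₀ ^ δ₀ * D₁ ^ Jc.card * t ^ (δ₀ + Jc.card) = (t * D₀) ^ δ₀ * (t * D₁) ^ Jc.card := by ring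
      _ ≤ (t * D₀ + 1) ^ δ₀ * (t * D₁ + 1) ^ Jc.card :=
        Nat.mul_le_mul (Nat.pow_le_pow_left (Nat.le_succ _) _) (Nat.pow_le_pow_left (Nat.le_succ _) _)
  -- the multiplicity and the limit
  obtain ⟨hHM, hmult1⟩ := hirr.hasMult (D₀ := D₀) (D₁ := D₁) hD₀ hD₁
  have hlim := hHM.tendsto
  rw [← hm] at hlim
  set M := mult D₀ D₁ (H₀ : Set (GaGm n)) with hM
  set c : ℕ := D₀ ^ δ₀ * D₁ ^ Jc.card with hc
  have hc1 : 1 ≤ c := Nat.mul_pos (Nat.pow_pos hD₀) (Nat.pow_pos hD₁)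
  -- `f t ≥ m! c t^{δ₀ + k - m}`
  have hf : ∀ t : ℕ, 1 ≤ t → ((m.factorial * c * t ^ (δ₀ + Jc.card - m) : ℕ) : ℝ) ≤
      ((m.factorial * hilb D₀ D₁ (H₀ : Set (GaGm n)) t : ℕ) : ℝ) / (t : ℝ) ^ m := by
    intro t ht
    have htpos : (0 : ℝ) < (t : ℝ) ^ m := by positivity
    rw [le_div_iff₀ htpos]
    have h1 := hlow t
    have h2 : m.factorial * c * t ^ (δ₀ + Jc.card - m) * t ^ m = m.factorial * (c * t ^ (δ₀ + Jc.card)) := by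
      rw [mul_assoc, mul_assoc, ← pow_add, Nat.sub_add_cancel hup]
    exact_mod_cast (show m.factorial * c * t ^ (δ₀ + Jc.card - m) * t ^ m ≤ m.factorial * hilb D₀ D₁ (H₀ : Set (GaGm n)) t by
      rw [h2]; exact Nat.mul_le_mul_left _ h1)
  -- hence `δ₀ + k ≤ m`
  have hle : δ₀ + Jc.card ≤ m := by
    by_contra hlt
    push Not at hlt
    have h := eq_zero_of_tendsto_of_mul_le hlim (c := m.factorial * c) (fun t ht => by
      refine le_trans ?_ (hf t ht)
      have : t ≤ t ^ (δ₀ + Jc.card - m) := by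
        calc t = t ^ 1 := (pow_one t).symm
          _ ≤ t ^ (δ₀ + Jc.card - m) := Nat.pow_le_pow_right ht (by omega)
      exact_mod_cast Nat.mul_le_mul_left _ this)
    have : 1 ≤ m.factorial * c := Nat.mul_pos (Nat.factorial_pos _) hc1
    omega
  have hmeq : m = δ₀ + Jc.card := le_antisymm hup hle
  refine ⟨hmeq, ?_⟩
  -- and `c ≤ M` by passing to the limit
  have hev : ∀ t : ℕ, 1 ≤ t → ((m.factorial * c : ℕ) : ℝ) ≤
      ((m.factorial * hilb D₀ D₁ (H₀ : Set (GaGm n)) t : ℕ) : ℝ) / (t : ℝ) ^ m := by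
    intro t ht
    have := hf t ht
    rwa [hmeq, Nat.sub_self, pow_zero, mul_one, ← hmeq] at this
  have hge : ((m.factorial * c : ℕ) : ℝ) ≤ (M : ℝ) :=
    ge_of_tendsto hlim (Filter.eventually_atTop.mpr ⟨1, hev⟩)
  have hge' : m.factorial * c ≤ M := by exact_mod_cast hge
  exact le_trans (Nat.le_mul_of_pos_left _ (Nat.factorial_pos _)) hge'

/-- `dim H₀ = dim V + dim T_A`. [folklore] -/
theorem dimG_eq_addDim_add_torusDim (H₀ : Subgroup (GaGm n)) (hirr : IsIrred (H₀ : Set (GaGm n))) :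
    dimG (H₀ : Set (GaGm n)) = (toConnAlgSubgroup H₀ hirr).addDim + (toConnAlgSubgroup H₀ hirr).torusDim :=
  (dimG_eq_and_pow_le_mult le_rfl le_rfl H₀ hirr).1

/-- **`mult_{D₀,D₁}(H₀) ≥ D₀^{dim V} D₁^{dim T_A}`.** [folklore] -/
theorem pow_le_mult {D₀ D₁ : ℕ} (hD₀ : 1 ≤ D₀) (hD₁ : 1 ≤ D₁) (H₀ : Subgroup (GaGm n))
    (hirr : IsIrred (H₀ : Set (GaGm n))) :
    D₀ ^ (toConnAlgSubgroup H₀ hirr).addDim * D₁ ^ (toConnAlgSubgroup H₀ hirr).torusDim ≤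
      mult D₀ D₁ (H₀ : Set (GaGm n)) :=
  (dimG_eq_and_pow_le_mult hD₀ hD₁ H₀ hirr).2

end GaGm

end Literature.NumberTheory.Transcendental
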